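import Literature.Geometry.Lorentzian.KillingFlowIsometry
import Literature.Geometry.Lorentzian.StationaryOrbitHorizontalFlow
import Literature.Geometry.Lorentzian.DalembertianNaturality
import Literature.Geometry.Lorentzian.MassCapacityHarmonic
import Literature.Geometry.Lorentzian.DalembertianCompose

/-!
# `ErgoregionBombModT` — transport of the zero-energy escape certificate along the cage
# (crux stmt-FinalStateConjecture-17838, line `SketchIdeator4`, stub `stub_certificateTransport` (U1))

Route `ZeroEnergyKerrOrBomb` of the Final State Conjecture, crux
`Summit.FinalStateConjecture.FinalStateConjecture.Theses.ZeroEnergyKerrOrBomb.ErgoregionBombModT`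
(the ergoregion bomb modulo the stationary flow), line `SketchIdeator4` (zero-energy escape),
skeleton v3 (`Cruxes/ErgoregionBombModT/Lines/SketchIdeator4.lean`): the kernel "zero-energy escape
certificates `(W, F, τ, c, C)` exist on the cage `⋃ₜ φₜ(S)` of every compact `S`" is reshaped as
`KERNEL ⇐ X ∧ U1 ∧ U2 ∧ ZF₀`.  This file proves the TRANSPORT step **U1**, the registered stub
`stub_certificateTransport`, verbatim:

* `hessian_comp_of_isometry` — **isometries preserve the covariant Hessian**: for a smooth self-map
  `Φ` of `(M, g)` with injective differentials and `g_{Φ y}(dΦ v, dΦ w) = g_y(v, w)`, and `f` of class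
  `C²` at `Φ u`, `Hess (f ∘ Φ)_u (X₀, Y₀) = Hess f_{Φ u} (dΦ X₀, dΦ Y₀)` (O'Neill 1983, Ch. 3,
  Prop. 3.59: isometries preserve `∇`, hence `∇df`; the tree's naturality `hessian_comap_apply` for
  the pullback metric `Φ^* g`, which IS `g`, transported across the propositional Levi-Civita
  instance exactly as in `PseudoRiemannianMetric.mfderiv_leviCivita_of_isometry`);
* `stub_certificateTransport` — on a stationary asymptotically flat black hole, for `W ⊇ ⋃ₜ φₜ(S)`
  open, `F, τ ∈ C²(W)` with `F` invariant and `τ` a Killing time (`τ ∘ φₜ = τ + t`) along the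
  integral curves of `T` issued from `W`, every point `x = φₜ(s)`, `s ∈ S`, of the cage carries the
  linear bijection `L = dφₜ|ₛ : T_s M → T_x M` preserving `g` (the flow maps are isometries,
  `StationaryAFBlackHole.exists_stationary_flow`), `g(·, T)` (`dφₜ T = T ∘ φₜ`,
  `mfderiv_flow_apply_self`), `dτ` (chain rule and `d(τ + t) = dτ`), `Hess F` and `Hess τ`
  (`hessian_comp_of_isometry`, locality `hessian_congr_of_eventuallyEq`, `Hess (τ + t) = Hess τ`).

References: B. O'Neill, *Semi-Riemannian geometry* (1983), Ch. 3, Def. 3.48–Lemma 3.49,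
Prop. 3.59; Ch. 9, Prop. 9.23–9.25 (Killing flows are isometries).
-/

noncomputable section

open Bundle Set Filter Function
open scoped Manifold Topology ContDiff

-- summit = problem name (D-0017)
set_option linter.dupNamespace false

namespace Summit.FinalStateConjecture.FinalStateConjecture.Theorems.ErgoregionBombModT

open Literature.Geometry.Lorentzian

section IsometryHessian

variable {E : Type*} [NormedAddCommGroup E] [NormedSpace ℝ E] {H : Type*} [TopologicalSpace H]
  {I : ModelWithCorners ℝ E H} {M : Type*} [TopologicalSpace M] [ChartedSpace H M]
  [IsManifold I ∞ M] [FiniteDimensional ℝ E] [CompleteSpace E]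
  {g : PseudoRiemannianMetric I ∞ E (TangentSpace I : M → Type _)} [g.HasLeviCivita]

/-- **Isometries preserve the covariant Hessian: `Hess (f ∘ Φ)_u (X₀, Y₀) = Hess f_{Φ u} (dΦ X₀, dΦ Y₀)`.**
Let `Φ : M → M` be a smooth map with injective (hence invertible) differentials which is isometric,
`g_{Φ y}(dΦ v, dΦ w) = g_y(v, w)`, and let `f` be of class `C²` at `Φ u`.  Then the Hessian of
`f ∘ Φ` at `u` is the Hessian of `f` at `Φ u` on the image vectors: the pullback metric `Φ^* g`
(`comap`) IS `g`, so this is the naturality of the Hessian under local diffeomorphisms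
(`PseudoRiemannianMetric.hessian_comap_apply`), transported across the propositional Levi-Civita
instance as in `PseudoRiemannianMetric.mfderiv_leviCivita_of_isometry`.  O'Neill 1983, Ch. 3,
Prop. 3.59 (isometries preserve the Levi-Civita connection, hence `Hess f = ∇(df)`, Def. 3.48).
[cite: ONeill1983, Ch. 3, Prop. 3.59] -/
theorem hessian_comp_of_isometry {Φ : M → M} (hΦ : ContMDiff I I (∞ + 1) Φ)
    (hΦ' : ∀ y, Function.Injective (mfderiv I I Φ y))
    (hiso : ∀ (y : M) (v w : TangentSpace I y),
      g.val (Φ y) (mfderiv I I Φ y v) (mfderiv I I Φ y w) = g.val y v w)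
    {f : M → ℝ} {u : M} (hf : ContMDiffAt I 𝓘(ℝ, ℝ) 2 f (Φ u)) (X₀ Y₀ : TangentSpace I u) :
    g.hessian (f ∘ Φ) u X₀ Y₀ =
      g.hessian f (Φ u) (mfderiv I I Φ u X₀) (mfderiv I I Φ u Y₀) := by
  have hpb : PseudoRiemannianMetric.contMDiff_pullbackBilin I M I M ∞ :=
    PseudoRiemannianMetric.contMDiff_pullbackBilin_holds
  have hdim : Module.finrank ℝ E = Module.finrank ℝ E := rfl
  -- `Φ^* g = g`
  have hgg : g.comap hpb Φ hΦ hΦ' hdim = g := by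
    ext y v w
    rw [PseudoRiemannianMetric.val_comap, pullbackBilin_apply, hiso]
  haveI : (g.comap hpb Φ hΦ hΦ' hdim).HasLeviCivita := (g.comap hpb Φ hΦ hΦ' hdim).hasLeviCivita
  have key := g.hessian_comap_apply hpb hΦ hΦ' hdim hf X₀ Y₀
  -- transport from `Φ^* g` to `g` (the Levi-Civita instance is a proposition)
  have aux : ∀ (g' : PseudoRiemannianMetric I ∞ E (TangentSpace I : M → Type _))
      [g'.HasLeviCivita], g' = g →
      g'.hessian (f ∘ Φ) u X₀ Y₀ =
        g.hessian f (Φ u) (mfderiv I I Φ u X₀) (mfderiv I I Φ u Y₀) →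
      g.hessian (f ∘ Φ) u X₀ Y₀ =
        g.hessian f (Φ u) (mfderiv I I Φ u X₀) (mfderiv I I Φ u Y₀) := by
    intro g' _ hg h
    subst hg
    exact h
  exact aux _ hgg key

omit [CompleteSpace E] in
/-- **The Hessian ignores additive constants: `Hess (u + c)_x = Hess u_x`** for `u` of class `C²`
at `x` (chain rule `hessian_real_comp` with `ζ(r) = r + c`, `ζ' = 1`, `ζ'' = 0`; file-local form of
the tree's `PseudoRiemannianMetric.hessian_add_const` of `GradientShrinkerProofs.lean`, sparing the
Riemannian import). O'Neill 1983, Ch. 3, Def. 3.48. [folklore] -/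
private theorem hessian_add_const_apply (c : ℝ) {u : M → ℝ} {x : M}
    (hu : ContMDiffAt I 𝓘(ℝ, ℝ) 2 u x) (v w : TangentSpace I x) :
    g.hessian (u + fun _ ↦ c) x v w = g.hessian u x v w := by
  have hζ : ContDiffAt ℝ 2 (fun r : ℝ ↦ r + c) (u x) :=
    (contDiff_id.add contDiff_const).contDiffAt
  have hd1 : deriv (fun r : ℝ ↦ r + c) = fun _ ↦ 1 := by
    funext r
    simp
  have hd2 : deriv (deriv fun r : ℝ ↦ r + c) (u x) = 0 := by
    rw [hd1, deriv_const]
  have h := g.hessian_real_comp (ζ := fun r : ℝ ↦ r + c) hu hζ v w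
  rw [show (u + fun _ ↦ c) = (fun r : ℝ ↦ r + c) ∘ u from rfl, h, hd2, hd1]
  ring

end IsometryHessian

section Transport

/-- **U1 — transport of the certificate data along the cage** (registered stub
`stub_certificateTransport` of line `SketchIdeator4`, crux stmt-FinalStateConjecture-17838, verbatim).
On a stationary asymptotically flat black hole let `W ⊇ ⋃ₜ φₜ(S)` be open, `F, τ ∈ C²(W)` with `F`
invariant and `τ` a Killing time along the integral curves of `T` issued from `W`.  Then for every
point `x` of the cage there are `s ∈ S` and a linear bijection `L : T_s M → T_x M` preserving `g`,
`g(·, T)`, `dτ`, `Hess F` and `Hess τ`.  Proof: `x = σ(t)` for an integral curve `σ` of `T` with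
`s := σ(0) ∈ S`, and `σ = φ_·(s)` is a flow line of the global stationary flow `φ`
(`StationaryAFBlackHole.exists_stationary_flow`, `eq_flow_of_isMIntegralCurve`); take `L := dφₜ|ₛ`.
It is bijective (`dφ₋ₜ ∘ dφₜ = id`, `mfderiv_flow_neg_apply_mfderiv_flow`), isometric (flow maps of a
Killing field are isometries, O'Neill 1983, Ch. 9, Prop. 9.23–9.25), carries `T_s` to `T_x`
(`mfderiv_flow_apply_self`), and since `τ ∘ φₜ = τ + t`, `F ∘ φₜ = F` on the open `W ∋ s`:
`dτ_x ∘ L = d(τ ∘ φₜ)_s = dτ_s` (chain rule), `Hess F_x (L·, L·) = Hess (F ∘ φₜ)_s = Hess F_s` and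
`Hess τ_x (L·, L·) = Hess (τ + t)_s = Hess τ_s` (`hessian_comp_of_isometry`, O'Neill 1983, Ch. 3,
Prop. 3.59; locality of `d` and `Hess`). [cite: ONeill1983, Ch. 3, Prop. 3.59] -/
theorem stub_certificateTransport :
    ∀ (𝓑 : Literature.Geometry.Lorentzian.StationaryAFBlackHole.{0}) [𝓑.metric.HasLeviCivita] (S W : Set 𝓑.carrier) (F τ : 𝓑.carrier → ℝ), IsOpen W → Literature.Geometry.Lorentzian.stationaryOrbit 𝓑.killing S ⊆ W → ContMDiffOn (𝓡 4) 𝓘(ℝ, ℝ) 2 F W → ContMDiffOn (𝓡 4) 𝓘(ℝ, ℝ) 2 τ W → (∀ σ : ℝ → 𝓑.carrier, IsMIntegralCurve σ 𝓑.killing → σ 0 ∈ W → ∀ t, F (σ t) = F (σ 0) ∧ τ (σ t) = τ (σ 0) + t) → ∀ x ∈ Literature.Geometry.Lorentzian.stationaryOrbit 𝓑.killing S, ∃ s ∈ S, ∃ L : TangentSpace (𝓡 4) s →L[ℝ] TangentSpace (𝓡 4) x, Function.Bijective L ∧ ∀ v : TangentSpace (𝓡 4) s, 𝓑.metric.val x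 (L v) (L v) = 𝓑.metric.val s v v ∧ 𝓑.metric.val x (L v) (𝓑.killing x) = 𝓑.metric.val s v (𝓑.killing s) ∧ mvfderiv (𝓡 4) τ x (L v) = mvfderiv (𝓡 4) τ s v ∧ 𝓑.metric.toPseudoRiemannianMetric.hessian F x (L v) (L v) = 𝓑.metric.toPseudoRiemannianMetric.hessian F s v v ∧ 𝓑.metric.toPseudoRiemannianMetric.hessian τ x (L v) (L v) = 𝓑.metric.toPseudoRiemannianMetric.hessian τ s v v := by
  intro 𝓑 _ S W F τ hW hSW hF hτ hinv x hx
  obtain ⟨γ, hγ, hγ0, t, rfl⟩ := hx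
  obtain ⟨θ, hθ, hθ0, hθadd, hθX, hiso, -⟩ := 𝓑.exists_stationary_flow
  have hK : 𝓑.metric.IsKillingField 𝓑.killing := 𝓑.isStationaryKilling.isKillingField
  have hθ2 : ContMDiff (𝓘(ℝ, ℝ).prod (𝓡 4)) (𝓡 4) 2 θ := hθ.of_le (WithTop.coe_le_coe.mpr le_top)
  have hK1 : ContMDiff (𝓡 4) (𝓡 4).tangent 1
      (fun x ↦ (⟨x, 𝓑.killing x⟩ : TangentBundle (𝓡 4) 𝓑.carrier)) :=
    hK.contMDiff.of_le (WithTop.coe_le_coe.mpr le_top)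
  -- both `s := γ 0` and `x := γ t` lie in the cage, hence in `W`; and `γ t = φₜ (γ 0)`
  have hsW : γ 0 ∈ W := hSW ⟨γ, hγ, hγ0, 0, rfl⟩
  have hxW : γ t ∈ W := hSW ⟨γ, hγ, hγ0, t, rfl⟩
  rw [eq_flow_of_isMIntegralCurve hK1 hθX hθ0 hγ t] at hxW ⊢
  -- the flow map `φₜ`: smooth, with injective differentials (inverse `dφ₋ₜ`), isometric (`hiso t`)
  have hΦ : ContMDiff (𝓡 4) (𝓡 4) (∞ + 1) (fun q ↦ θ (t, q)) := by
    have h1 : ContMDiff (𝓡 4) (𝓡 4) ∞ (fun q ↦ θ (t, q)) :=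
      hθ.comp (contMDiff_const.prodMk contMDiff_id)
    exact h1.of_le le_rfl
  have hΦ' : ∀ y, Function.Injective (mfderiv (𝓡 4) (𝓡 4) (fun q ↦ θ (t, q)) y) := fun y ↦
    Function.LeftInverse.injective
      (g := mfderiv (𝓡 4) (𝓡 4) (fun q ↦ θ (-t, q)) (θ (t, y)))
      (PseudoRiemannianMetric.mfderiv_flow_neg_apply_mfderiv_flow hθ2 hθ0 hθadd t y)
  have hdim : Module.finrank ℝ E4 = Module.finrank ℝ E4 := rfl
  have hΦd : MDifferentiableAt (𝓡 4) (𝓡 4) (fun q ↦ θ (t, q)) (γ 0) :=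
    PseudoRiemannianMetric.mdifferentiableAt_flow hθ2 t (γ 0)
  have hself : mfderiv (𝓡 4) (𝓡 4) (fun q ↦ θ (t, q)) (γ 0) (𝓑.killing (γ 0)) =
      𝓑.killing (θ (t, γ 0)) :=
    mfderiv_flow_apply_self hθ2 hθ0 hθadd hθX t (γ 0)
  -- `F ∘ φₜ = F` and `τ ∘ φₜ = τ + t` near `γ 0` (on the open `W`)
  have hflowW : ∀ y ∈ W, F (θ (t, y)) = F (θ (0, y)) ∧ τ (θ (t, y)) = τ (θ (0, y)) + t :=
    fun y hy ↦ hinv (fun r ↦ θ (r, y)) (hθX y) (show θ (0, y) ∈ W by rw [hθ0]; exact hy) t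
  have hFev : (F ∘ fun q ↦ θ (t, q)) =ᶠ[𝓝 (γ 0)] F := by
    filter_upwards [hW.mem_nhds hsW] with y hy
    show F (θ (t, y)) = F y
    have h := (hflowW y hy).1
    rwa [hθ0] at h
  have hτev : (τ ∘ fun q ↦ θ (t, q)) =ᶠ[𝓝 (γ 0)] (τ + fun _ ↦ t) := by
    filter_upwards [hW.mem_nhds hsW] with y hy
    show τ (θ (t, y)) = τ y + t
    have h := (hflowW y hy).2
    rwa [hθ0] at h
  -- regularity of `F`, `τ` at `γ 0 ∈ W` and at `φₜ (γ 0) ∈ W`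
  have hF2 : ContMDiffAt (𝓡 4) 𝓘(ℝ, ℝ) 2 F (θ (t, γ 0)) := hF.contMDiffAt (hW.mem_nhds hxW)
  have hτ2 : ContMDiffAt (𝓡 4) 𝓘(ℝ, ℝ) 2 τ (θ (t, γ 0)) := hτ.contMDiffAt (hW.mem_nhds hxW)
  have hτ2s : ContMDiffAt (𝓡 4) 𝓘(ℝ, ℝ) 2 τ (γ 0) := hτ.contMDiffAt (hW.mem_nhds hsW)
  have hτd : MDifferentiableAt (𝓡 4) 𝓘(ℝ, ℝ) τ (θ (t, γ 0)) := hτ2.mdifferentiableAt two_ne_zero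
  have hτds : MDifferentiableAt (𝓡 4) 𝓘(ℝ, ℝ) τ (γ 0) := hτ2s.mdifferentiableAt two_ne_zero
  have hcd : MDifferentiableAt (𝓡 4) 𝓘(ℝ, ℝ) (fun _ : 𝓑.carrier ↦ t) (γ 0) :=
    mdifferentiableAt_const
  refine ⟨γ 0, hγ0, mfderiv (𝓡 4) (𝓡 4) (fun q ↦ θ (t, q)) (γ 0),
    mfderiv_bijective_of_injective (hΦ' (γ 0)) hdim,
    fun v ↦ ⟨hiso t (γ 0) v v, ?_, ?_, ?_, ?_⟩⟩
  · -- `g(L v, T_x) = g(v, T_s)`: `T_x = dφₜ (T_s)` and `dφₜ` is isometric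
    rw [← hself]
    exact hiso t (γ 0) v (𝓑.killing (γ 0))
  · -- `dτ_x (L v) = d(τ ∘ φₜ)_s (v) = d(τ + t)_s (v) = dτ_s (v)`
    rw [← PseudoRiemannianMetric.mvfderiv_comp_apply (Φ := fun q ↦ θ (t, q)) (u := γ 0) hτd hΦd v,
      mvfderiv_congr_of_eventuallyEq hτev, mvfderiv_add hτds hcd, mvfderiv_const, add_zero]
  · -- `Hess F_x (L v, L v) = Hess (F ∘ φₜ)_s (v, v) = Hess F_s (v, v)`
    rw [← hessian_comp_of_isometry hΦ hΦ' (hiso t) hF2 v v,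
      𝓑.metric.toPseudoRiemannianMetric.hessian_congr_of_eventuallyEq hFev]
  · -- `Hess τ_x (L v, L v) = Hess (τ ∘ φₜ)_s (v, v) = Hess (τ + t)_s (v, v) = Hess τ_s (v, v)`
    rw [← hessian_comp_of_isometry hΦ hΦ' (hiso t) hτ2 v v,
      𝓑.metric.toPseudoRiemannianMetric.hessian_congr_of_eventuallyEq hτev,
      hessian_add_const_apply t hτ2s v v]

end Transport

end Summit.FinalStateConjecture.FinalStateConjecture.Theorems.ErgoregionBombModT

end
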